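import Summits.KontsevichZagierPeriods.KontsevichZagierPeriods.Theorems.HurwitzMicroSectorsNormalFormPrincipleLevelOne
import Summits.KontsevichZagierPeriods.KontsevichZagierPeriods.Theorems.HurwitzMicroSectorsNormalFormPrincipleSlabASubPtK20
import Summits.KontsevichZagierPeriods.KontsevichZagierPeriods.Theorems.HurwitzMicroSectorsNormalFormPrincipleAlgCarriers
import Summits.KontsevichZagierPeriods.KontsevichZagierPeriods.Theorems.HurwitzMicroSectorsNormalFormPrincipleM2FiveZetaTwo
import Summits.KontsevichZagierPeriods.KontsevichZagierPeriods.Theorems.AperySectorThreeTwo.Negative.Kit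

/-!
# `NormalFormPrinciple` (stmt-KontsevichZagierPeriods-3869), line `SketchIdeator1` — leaf `stub_boxRigidity`:
# weight three, level `K`, totally off resonance: the merge `t = xyz` and the two coordinate transpositions (rule 2)

Pure proof file (`--supports` the crux). Registered sub-goal `merge3_and_perm` of the layer
"Conjecture 1 for the boxes `[(0,1)³, c x^A y^B z^D/(1 − x^K y^K z^K)]` totally off resonance"
(lead file `…Weight3`), for a level `K ≥ 1` and a real-algebraic coefficient `c`:

1. MERGE `t = x₀x₁x₂` (for `D < A`, `D < B`): the box representation
   `N = [(0,1)³, c x₀^A x₁^B x₂^D/(1 − x₀^K x₁^K x₂^K)]` and the band representation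
   `R = [{(x₀,x₁) ∈ (0,1)², 0 ≤ t ≤ x₀x₁}, c x₀^{A−D−1} x₁^{B−D−1} t^D/(1 − t^K)]` differ by a
   relation: `N` is congruent (rule 1: the two null faces `x₂ ∈ {0, 1}`,
   `KZ.IntegralRep.of_sub_of_restrict_mem_relations`, `KZ.of_sub_of_mem_relations_of_eqOn`) to
   the same integrand on the band-box `(0,1)² × [0,1]` (where
   `1 − x₀^K x₁^K x₂^K = 1 − (x₀x₁x₂)^K > 0`), which the substitution `t = (x₀x₁)·x₂` along the
   last coordinate over the OPEN base `(0,1)²` (`KZ.of_sub_of_mem_relations_of_affine`, `α = 0`,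
   `β = x₀x₁ > 0`, Jacobian `x₀x₁`) carries onto `R`:
   `c x₀^{A−D−1} x₁^{B−D−1} (x₀x₁x₂)^D/(1 − (x₀x₁x₂)^K) · x₀x₁ = c x₀^A x₁^B x₂^D/(1 − x₀^K x₁^K x₂^K)`.
2. The TRANSPOSITIONS `x₀ ↔ x₁` and `x₁ ↔ x₂` of the box (rule 2:
   `KZ.of_sub_of_reindex_mem_relations` with `Equiv.swap 0 1`, resp. `Equiv.swap 1 2`, then
   congruence of the integrands; the open box and the kernel `1 − x₀^K x₁^K x₂^K` are invariant
   under coordinate permutations).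

Port, one dimension up, of `…PiBox.LevelK.lk_merge_box_sub_triangle`,
`…PiBox.LevelK.lk_swap_monomial_sub_mem_relations` and of `…PiBox.LevelOne.merge_box_sub_band_dim`.
References: M. Kontsevich, D. Zagier, *Periods* (2001), §1.2 rules (1), (2). No new definitions.
-/

noncomputable section

open MeasureTheory Set
open Literature.NumberTheory.Transcendental Literature.NumberTheory.Transcendental.KZ
open Literature.ModelTheory.ExponentialFields (IsSemialgebraic)

namespace Summit.KontsevichZagierPeriods.HurwitzMicroSectors.NormalFormPrinciple.PiBox.Weight3

/-- The weight-three level-`K` merge identity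
`c x^A y^B t^D/(1 − x^K y^K t^K) = c x^{A−D−1} y^{B−D−1} (x y t)^D/(1 − (x y t)^K) · (x y)` for
`D < A`, `D < B` (`A = (A − D − 1) + D + 1`, `B = (B − D − 1) + D + 1`, `(x y t)^K = x^K y^K t^K`).
[folklore] -/
theorem w3_merge_identity {A B D : ℕ} (hDA : D < A) (hDB : D < B) (K : ℕ) (c x y t : ℝ) :
    c * (x ^ A * y ^ B * t ^ D) / (1 - x ^ K * y ^ K * t ^ K) =
      c * (x ^ (A - D - 1) * y ^ (B - D - 1) * (x * y * t) ^ D) / (1 - (x * y * t) ^ K) *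
        (x * y) := by
  obtain ⟨k, rfl⟩ : ∃ k, A = D + 1 + k := ⟨A - (D + 1), by omega⟩
  obtain ⟨l, rfl⟩ : ∃ l, B = D + 1 + l := ⟨B - (D + 1), by omega⟩
  have hk : D + 1 + k - D - 1 = k := by omega
  have hl : D + 1 + l - D - 1 = l := by omega
  rw [hk, hl]
  simp only [mul_pow]
  ring

/-- Coordinates of the substituted point `Fin.snoc (Fin.init z) v = (z₀, z₁, v)` of `ℝ³`: the
first one. [folklore] -/
theorem w3_snoc_init_apply_zero (z : Fin 3 → ℝ) (v : ℝ) :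
    (Fin.snoc (Fin.init z) v : Fin 3 → ℝ) 0 = z 0 := rfl

/-- Coordinates of the substituted point `Fin.snoc (Fin.init z) v = (z₀, z₁, v)` of `ℝ³`: the
second one. [folklore] -/
theorem w3_snoc_init_apply_one (z : Fin 3 → ℝ) (v : ℝ) :
    (Fin.snoc (Fin.init z) v : Fin 3 → ℝ) 1 = z 1 := rfl

/-- Coordinates of the substituted point `Fin.snoc (Fin.init z) v = (z₀, z₁, v)` of `ℝ³`: the
last one. [folklore] -/
theorem w3_snoc_init_apply_two (z : Fin 3 → ℝ) (v : ℝ) :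
    (Fin.snoc (Fin.init z) v : Fin 3 → ℝ) 2 = v := rfl

/-- The weight-three merge identity at a point `z` of the band-box, the substituted point being
`(z₀, z₁, z₀z₁z₂) = Fin.snoc (Fin.init z) (0 + z₀ z₁ · z₂)` (the shape produced by
`KZ.of_sub_of_mem_relations_of_affine` with `α = 0`, `β = z₀z₁`). [folklore] -/
theorem w3_merge_identity_snoc {A B D : ℕ} (hDA : D < A) (hDB : D < B) (K : ℕ) (c : ℝ)
    (z : Fin 3 → ℝ) :
    c * (z 0 ^ A * z 1 ^ B * z 2 ^ D) / (1 - z 0 ^ K * z 1 ^ K * z 2 ^ K) =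
      c * ((Fin.snoc (Fin.init z) (0 + Fin.init z 0 * Fin.init z 1 * z (Fin.last 2)) :
              Fin 3 → ℝ) 0 ^ (A - D - 1) *
            (Fin.snoc (Fin.init z) (0 + Fin.init z 0 * Fin.init z 1 * z (Fin.last 2)) :
              Fin 3 → ℝ) 1 ^ (B - D - 1) *
            (Fin.snoc (Fin.init z) (0 + Fin.init z 0 * Fin.init z 1 * z (Fin.last 2)) :
              Fin 3 → ℝ) 2 ^ D) /
          (1 - (Fin.snoc (Fin.init z) (0 + Fin.init z 0 * Fin.init z 1 * z (Fin.last 2)) :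
            Fin 3 → ℝ) 2 ^ K) *
        (Fin.init z 0 * Fin.init z 1) := by
  have hi0 : Fin.init z 0 = z 0 := rfl
  have hi1 : Fin.init z 1 = z 1 := rfl
  have hl : z (Fin.last 2) = z 2 := rfl
  rw [w3_snoc_init_apply_zero, w3_snoc_init_apply_one, w3_snoc_init_apply_two, hi0, hi1, hl,
    zero_add]
  exact w3_merge_identity hDA hDB K c (z 0) (z 1) (z 2)

/-- On the band-box `(0,1)² × [0,1]` the level-`K` denominator is positive for `K ≠ 0`:
`0 < 1 − x₀^K x₁^K x₂^K` (since `x₀^K x₁^K x₂^K = (x₀x₁x₂)^K` and `0 ≤ x₀x₁x₂ < 1`). [folklore] -/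
theorem w3_denom_pos {K : ℕ} (hK : K ≠ 0) {x : Fin 3 → ℝ}
    (h : (0 < x 0 ∧ x 0 < 1) ∧ (0 < x 1 ∧ x 1 < 1) ∧ 0 ≤ x 2 ∧ x 2 ≤ 1) :
    0 < 1 - x 0 ^ K * x 1 ^ K * x 2 ^ K := by
  obtain ⟨h0, h1, h2, h2'⟩ := h
  have hp01 : 0 ≤ x 0 * x 1 := mul_nonneg h0.1.le h1.1.le
  have hp : 0 ≤ x 0 * x 1 * x 2 := mul_nonneg hp01 h2
  have hle01 : x 0 * x 1 ≤ x 0 := mul_le_of_le_one_right h0.1.le h1.2.le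
  have hlt : x 0 * x 1 * x 2 < 1 :=
    lt_of_le_of_lt (mul_le_of_le_one_right hp01 h2') (lt_of_le_of_lt hle01 h0.2)
  rw [← mul_pow, ← mul_pow]
  exact sub_pos.2 (pow_lt_one₀ hp hlt hK)

/-- The integrand `c x₀^A x₁^B x₂^D/(1 − x₀^K x₁^K x₂^K)` (`K ≠ 0`) with a real-algebraic
coefficient `c` is `ℚ`-semialgebraic on the band-box `(0,1)² × [0,1]` (where its denominator is
positive): the product of the `ℚ`-definable constant `c` and a quotient of polynomials over `ℚ`.
[cite: KontsevichZagier2001, §1.1] -/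
theorem w3_isSemialgebraicFunOn_alg_monomial_div {K : ℕ} (hK : K ≠ 0) (A B D : ℕ) {c : ℝ}
    (hc : IsAlgebraic ℚ c)
    (hB : IsSemialgebraic ℚ (KZlog.band {y : Fin 2 → ℝ | ∀ i, y i ∈ Set.Ioo (0:ℝ) 1}
      (fun _ => (0:ℝ)) (fun _ => (1:ℝ)))) :
    IsSemialgebraicFunOn ℚ
      (KZlog.band {y : Fin 2 → ℝ | ∀ i, y i ∈ Set.Ioo (0:ℝ) 1} (fun _ => (0:ℝ)) (fun _ => (1:ℝ)))
      (fun x => c * (x 0 ^ A * x 1 ^ B * x 2 ^ D) / (1 - x 0 ^ K * x 1 ^ K * x 2 ^ K)) := by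
  have hq : ∀ x ∈ KZlog.band {y : Fin 2 → ℝ | ∀ i, y i ∈ Set.Ioo (0:ℝ) 1} (fun _ => (0:ℝ))
      (fun _ => (1:ℝ)),
      MvPolynomial.aeval x (1 - MvPolynomial.X 0 ^ K * MvPolynomial.X 1 ^ K *
        MvPolynomial.X 2 ^ K : MvPolynomial (Fin 3) ℚ) ≠ 0 := by
    intro x hx
    have h : (0 < x 0 ∧ x 0 < 1) ∧ (0 < x 1 ∧ x 1 < 1) ∧ 0 ≤ x 2 ∧ x 2 ≤ 1 :=
      ⟨hx.1 0, hx.1 1, hx.2.1, hx.2.2⟩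
    simp only [map_sub, map_mul, map_one, map_pow, MvPolynomial.aeval_X]
    exact (w3_denom_pos hK h).ne'
  refine (IsSemialgebraicFunOn.mul_holds (isSemialgebraicFunOn_const_of_isAlgebraic hB hc)
    (isSemialgebraicFunOn_aeval_div_aeval hB
      (MvPolynomial.X 0 ^ A * MvPolynomial.X 1 ^ B * MvPolynomial.X 2 ^ D)
      (1 - MvPolynomial.X 0 ^ K * MvPolynomial.X 1 ^ K * MvPolynomial.X 2 ^ K) hq)).congr
    fun x _ => ?_
  simp only [Pi.mul_apply, map_sub, map_mul, map_one, map_pow, MvPolynomial.aeval_X]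
  ring

/-- **The weight-three merge `t = x₀x₁x₂` with a real-algebraic coefficient** (Kontsevich–Zagier
rules 1, 2). For `0 < K`, `D < A`, `D < B` and `c` real algebraic, the box representation
`N = [(0,1)³, c x₀^A x₁^B x₂^D/(1 − x₀^K x₁^K x₂^K)]` and the band representation
`R = [{(x₀,x₁) ∈ (0,1)², 0 ≤ t ≤ x₀x₁}, c x₀^{A−D−1} x₁^{B−D−1} t^D/(1 − t^K)]` differ by a
relation: `N` is congruent (rule 1, the two null faces `x₂ ∈ {0,1}`) to the same integrand on the
band-box `(0,1)² × [0,1]`, which the substitution `t = x₀x₁·x₂` along the last coordinate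
(`KZ.of_sub_of_mem_relations_of_affine` over the open base `(0,1)²`, `α = 0`, `β = x₀x₁`,
Jacobian `x₀x₁`) carries onto `R`, with
`c x₀^{A−D−1} x₁^{B−D−1} (x₀x₁x₂)^D/(1 − (x₀x₁x₂)^K) · x₀x₁ = c x₀^A x₁^B x₂^D/(1 − x₀^K x₁^K x₂^K)`.
[cite: KontsevichZagier2001, §1.2 rules (1), (2)] -/
theorem w3_merge_box_sub_band (K : ℕ) (hK : 0 < K) (A B D : ℕ) (c : ℝ) (hc : IsAlgebraic ℚ c)
    (hDA : D < A) (hDB : D < B) (N R : IntegralRep 3)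
    (hNd : N.domain = {x | ∀ i, x i ∈ Set.Ioo (0:ℝ) 1})
    (hNi : EqOn N.integrand (fun x => c * (x 0 ^ A * x 1 ^ B * x 2 ^ D) /
      (1 - x 0 ^ K * x 1 ^ K * x 2 ^ K)) N.domain)
    (hRd : R.domain = KZlog.band {y : Fin 2 → ℝ | ∀ i, y i ∈ Set.Ioo (0:ℝ) 1} (fun _ => (0:ℝ))
      (fun y => y 0 * y 1))
    (hRi : EqOn R.integrand (fun z => c * (z 0 ^ (A - D - 1) * z 1 ^ (B - D - 1) * z 2 ^ D) /
      (1 - z 2 ^ K)) R.domain) :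
    of N - of R ∈ relations := by
  have hK0 : K ≠ 0 := Nat.pos_iff_ne_zero.1 hK
  -- the open base `G = (0,1)²` and the band-box `B₀ = G × [0,1]` over it
  have hG : IsSemialgebraic ℚ {y : Fin 2 → ℝ | ∀ i, y i ∈ Set.Ioo (0:ℝ) 1} :=
    isSemialgebraic_box 2
  have hGo : IsOpen {y : Fin 2 → ℝ | ∀ i, y i ∈ Set.Ioo (0:ℝ) 1} := by
    rw [Set.setOf_forall]
    exact isOpen_iInter_of_finite fun i => isOpen_Ioo.preimage (continuous_apply i)
  have hα : IsSemialgebraicFunOn ℚ {y : Fin 2 → ℝ | ∀ i, y i ∈ Set.Ioo (0:ℝ) 1}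
      (fun _ => (0:ℝ)) := by
    simpa using isSemialgebraicFunOn_ratCast hG 0
  have hone : IsSemialgebraicFunOn ℚ {y : Fin 2 → ℝ | ∀ i, y i ∈ Set.Ioo (0:ℝ) 1}
      (fun _ => (1:ℝ)) := by
    simpa using isSemialgebraicFunOn_ratCast hG 1
  have hβ : IsSemialgebraicFunOn ℚ {y : Fin 2 → ℝ | ∀ i, y i ∈ Set.Ioo (0:ℝ) 1}
      (fun y => y 0 * y 1) :=
    IsSemialgebraicFunOn.mul_holds (isSemialgebraicFunOn_apply hG 0)
      (isSemialgebraicFunOn_apply hG 1)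
  have hβd : DifferentiableOn ℝ (fun y : Fin 2 → ℝ => y 0 * y 1)
      {y : Fin 2 → ℝ | ∀ i, y i ∈ Set.Ioo (0:ℝ) 1} :=
    (differentiableOn_apply 0 _).mul (differentiableOn_apply 1 _)
  have hB : IsSemialgebraic ℚ (KZlog.band {y : Fin 2 → ℝ | ∀ i, y i ∈ Set.Ioo (0:ℝ) 1}
      (fun _ => (0:ℝ)) (fun _ => (1:ℝ))) :=
    KZlog.isSemialgebraic_band hα hone
  -- coordinates of a point of the band-box: `z₀, z₁ ∈ (0,1)`, `z₂ ∈ [0,1]`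
  have hmemB : ∀ z ∈ KZlog.band {y : Fin 2 → ℝ | ∀ i, y i ∈ Set.Ioo (0:ℝ) 1}
      (fun _ => (0:ℝ)) (fun _ => (1:ℝ)),
      (0 < z 0 ∧ z 0 < 1) ∧ (0 < z 1 ∧ z 1 < 1) ∧ 0 ≤ z 2 ∧ z 2 ≤ 1 :=
    fun z hz => ⟨hz.1 0, hz.1 1, hz.2.1, hz.2.2⟩
  -- the explicit box integrand is semialgebraic on the band-box ...
  have hsa := w3_isSemialgebraicFunOn_alg_monomial_div hK0 A B D hc hB
  -- ... and integrable there: the band-box is the open box plus two null faces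
  have hNint : IntegrableOn (fun x : Fin 3 → ℝ => c * (x 0 ^ A * x 1 ^ B * x 2 ^ D) /
      (1 - x 0 ^ K * x 1 ^ K * x 2 ^ K)) N.domain :=
    N.integrableOn.congr_fun hNi (IntegralRep.measurableSet_domain_holds N)
  have hsub : KZlog.band {y : Fin 2 → ℝ | ∀ i, y i ∈ Set.Ioo (0:ℝ) 1} (fun _ => (0:ℝ))
      (fun _ => (1:ℝ)) ⊆
      N.domain ∪ ({z | z (Fin.last 2) = 0} ∪ {z | z (Fin.last 2) = 1}) := by
    intro z hz
    obtain ⟨h0, h1, h2, h2'⟩ := hmemB z hz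
    rcases h2.eq_or_lt with h2 | h2
    · exact Or.inr (Or.inl h2.symm)
    rcases h2'.lt_or_eq with h2' | h2'
    · refine Or.inl ?_
      rw [hNd, Set.mem_setOf_eq]
      intro i
      fin_cases i
      exacts [h0, h1, ⟨h2, h2'⟩]
    · exact Or.inr (Or.inr h2')
  have hint : IntegrableOn (fun x : Fin 3 → ℝ => c * (x 0 ^ A * x 1 ^ B * x 2 ^ D) /
      (1 - x 0 ^ K * x 1 ^ K * x 2 ^ K))
      (KZlog.band {y : Fin 2 → ℝ | ∀ i, y i ∈ Set.Ioo (0:ℝ) 1} (fun _ => (0:ℝ))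
        (fun _ => (1:ℝ))) :=
    (hNint.union ((IntegrableOn.of_measure_zero (volume_setOf_last_eq_zero 0)).union
      (IntegrableOn.of_measure_zero (volume_setOf_last_eq_zero 1)))).mono_set hsub
  -- the representation `r = [B₀, c x₀^A x₁^B x₂^D/(1 − x₀^K x₁^K x₂^K)]`
  obtain ⟨r, hrd, hri⟩ : ∃ r : IntegralRep 3,
      r.domain = KZlog.band {y : Fin 2 → ℝ | ∀ i, y i ∈ Set.Ioo (0:ℝ) 1} (fun _ => (0:ℝ))
        (fun _ => (1:ℝ)) ∧
      r.integrand = fun x => c * (x 0 ^ A * x 1 ^ B * x 2 ^ D) /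
        (1 - x 0 ^ K * x 1 ^ K * x 2 ^ K) :=
    ⟨⟨_, _, hB, hsa, hint⟩, rfl, rfl⟩
  -- (rule 1) `N` versus `r`: restriction to the open box and congruence
  have hEr : N.domain ⊆ r.domain := by
    intro z hz
    rw [hNd, Set.mem_setOf_eq] at hz
    rw [hrd]
    exact ⟨fun i => hz (Fin.castSucc i), (hz (Fin.last 2)).1.le, (hz (Fin.last 2)).2.le⟩
  have hnull : volume (r.domain \ N.domain) = 0 := by
    refine measure_mono_null (fun z hz => ?_)
      (measure_union_null (volume_setOf_last_eq_zero (n := 2) 0)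
        (volume_setOf_last_eq_zero (n := 2) 1))
    rcases hsub (hrd ▸ hz.1) with h | h
    · exact absurd h hz.2
    · exact h
  have e1 : of r - of (r.restrict N.domain N.isSemialgebraic_domain hEr) ∈ relations :=
    r.of_sub_of_restrict_mem_relations N.isSemialgebraic_domain hEr hnull
  have e2 : of N - of (r.restrict N.domain N.isSemialgebraic_domain hEr) ∈ relations :=
    of_sub_of_mem_relations_of_eqOn rfl (by rw [IntegralRep.integrand_restrict, hri]; exact hNi)
  -- (rule 2) `r` versus `R`: the substitution `t = x₀x₁ · x₂` along the last coordinate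
  have key : ∀ z ∈ r.domain, r.integrand z =
      R.integrand (Fin.snoc (Fin.init z) (0 + Fin.init z 0 * Fin.init z 1 * z (Fin.last 2))) *
        (Fin.init z 0 * Fin.init z 1) := by
    intro z hz
    rw [hrd] at hz
    obtain ⟨h0, h1, h2, h2'⟩ := hmemB z hz
    have hp : 0 ≤ z 0 * z 1 := mul_nonneg h0.1.le h1.1.le
    have hw : (Fin.snoc (Fin.init z) (0 + Fin.init z 0 * Fin.init z 1 * z (Fin.last 2)) :
        Fin 3 → ℝ) ∈ R.domain := by
      rw [hRd]
      refine KZlog.mem_band.2 ?_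
      rw [Fin.init_snoc, Fin.snoc_last]
      refine ⟨hz.1, ?_, ?_⟩
      · show (0:ℝ) ≤ 0 + z 0 * z 1 * z 2
        rw [zero_add]
        exact mul_nonneg hp h2
      · show 0 + z 0 * z 1 * z 2 ≤ z 0 * z 1
        rw [zero_add]
        exact mul_le_of_le_one_right hp h2'
    rw [hRi hw, hri]
    exact w3_merge_identity_snoc hDA hDB K c z
  have e3 : of r - of R ∈ relations :=
    of_sub_of_mem_relations_of_affine (m := 2) hGo (α := fun _ => (0:ℝ))
      (β := fun y => y 0 * y 1) (a := fun _ => (0:ℝ)) (b := fun _ => (1:ℝ))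
      (a' := fun _ => (0:ℝ)) (b' := fun y => y 0 * y 1) hα hβ (differentiableOn_const 0) hβd
      (fun y hy => mul_pos (hy 0).1 (hy 1).1) r R hrd hRd (fun y _ => by ring)
      (fun y _ => by ring) key
  -- bookkeeping
  have e : of N - of R = (of N - of (r.restrict N.domain N.isSemialgebraic_domain hEr)) -
      (of r - of (r.restrict N.domain N.isSemialgebraic_domain hEr)) + (of r - of R) := by
    abel
  rw [e]
  exact relations.add_mem (relations.sub_mem e2 e1) e3

/-- **Coordinate permutations of the open box `(0,1)³`** (rule 2): if `N = [(0,1)³, f]` and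
`N' = [(0,1)³, g]` with `f (w ∘ σ) = g w` for a permutation `σ` of the three coordinates, then
`[N] − [N'] ∈ relations`, by reindexing along `σ` (`KZ.of_sub_of_reindex_mem_relations`; the open
box is permutation invariant) and congruence of the integrands on the box.
[cite: KontsevichZagier2001, §1.2 rule (2)] -/
theorem w3_perm_box_sub_mem_relations (σ : Equiv.Perm (Fin 3)) (f g : (Fin 3 → ℝ) → ℝ)
    (N N' : IntegralRep 3)
    (hNd : N.domain = {x | ∀ i, x i ∈ Set.Ioo (0:ℝ) 1}) (hNi : EqOn N.integrand f N.domain)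
    (hN'd : N'.domain = {x | ∀ i, x i ∈ Set.Ioo (0:ℝ) 1}) (hN'i : EqOn N'.integrand g N'.domain)
    (hfg : ∀ w : Fin 3 → ℝ, f (fun i => w (σ i)) = g w) :
    of N - of N' ∈ relations := by
  have h1 := of_sub_of_reindex_mem_relations N σ
  have hd : (N.reindex σ).domain = {x | ∀ i, x i ∈ Set.Ioo (0:ℝ) 1} := by
    ext w
    simp only [IntegralRep.reindex_domain, hNd, mem_setOf_eq]
    exact ⟨fun h i => by simpa using h (σ.symm i), fun h i => h (σ i)⟩
  have h2 : of (N.reindex σ) - of N' ∈ relations := by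
    refine of_sub_of_mem_relations_of_eqOn (hN'd.trans hd.symm) fun w hw => ?_
    have hw' : (fun i => w (σ i)) ∈ N.domain := hw
    rw [IntegralRep.reindex_integrand]
    show N.integrand (fun i => w (σ i)) = N'.integrand w
    rw [hNi hw', hN'i (hN'd ▸ hd ▸ hw), hfg]
  have e : of N - of N' = (of N - of (N.reindex σ)) + (of (N.reindex σ) - of N') := by abel
  rw [e]
  exact relations.add_mem h1 h2

/-- **Stub W2 (merge `t = xyz` for the kernel `1/(1 − x^K y^K z^K)` and the two coordinate
transpositions, rule 2).** For a level `K ≥ 1`, a real-algebraic coefficient `c` and exponents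
`A, B, D`:
(1) if `D < A` and `D < B`, the box representation `[(0,1)³, c x₀^A x₁^B x₂^D/(1 − x₀^K x₁^K x₂^K)]`
and the band representation `[{(x₀,x₁) ∈ (0,1)², 0 ≤ t ≤ x₀x₁}, c x₀^{A−D−1} x₁^{B−D−1} t^D/(1 − t^K)]`
differ by a KZ relation (null faces, rule 1, then the merge substitution `t = x₀x₁x₂` along the
last coordinate, rule 2: `x₀^K x₁^K (t/(x₀x₁))^K = t^K`);
(2), (3) the box representations with integrands `c x₀^A x₁^B x₂^D/(1 − x₀^K x₁^K x₂^K)` and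
`c x₀^B x₁^A x₂^D/(…)`, resp. `c x₀^A x₁^D x₂^B/(…)`, differ by a KZ relation (the transpositions
`x₀ ↔ x₁`, `x₁ ↔ x₂`, rule 2; the kernel is permutation invariant).
[cite: KontsevichZagier2001, §1.2 rules (1), (2)] -/
theorem merge3_and_perm (K : ℕ) (hK : 0 < K) (A B D : ℕ) (c : ℝ) (hc : IsAlgebraic ℚ c) :
    (D < A → D < B → ∀ (N R : IntegralRep 3),
      N.domain = {x | ∀ i, x i ∈ Set.Ioo (0:ℝ) 1} →
      EqOn N.integrand (fun x => c * (x 0 ^ A * x 1 ^ B * x 2 ^ D) /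
        (1 - x 0 ^ K * x 1 ^ K * x 2 ^ K)) N.domain →
      R.domain = KZlog.band {y : Fin 2 → ℝ | ∀ i, y i ∈ Set.Ioo (0:ℝ) 1} (fun _ => (0:ℝ))
        (fun y => y 0 * y 1) →
      EqOn R.integrand (fun z => c * (z 0 ^ (A - D - 1) * z 1 ^ (B - D - 1) * z 2 ^ D) /
        (1 - z 2 ^ K)) R.domain →
      of N - of R ∈ relations) ∧
    (∀ (N N' : IntegralRep 3),
      N.domain = {x | ∀ i, x i ∈ Set.Ioo (0:ℝ) 1} →
      EqOn N.integrand (fun x => c * (x 0 ^ A * x 1 ^ B * x 2 ^ D) /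
        (1 - x 0 ^ K * x 1 ^ K * x 2 ^ K)) N.domain →
      N'.domain = {x | ∀ i, x i ∈ Set.Ioo (0:ℝ) 1} →
      EqOn N'.integrand (fun x => c * (x 0 ^ B * x 1 ^ A * x 2 ^ D) /
        (1 - x 0 ^ K * x 1 ^ K * x 2 ^ K)) N'.domain →
      of N - of N' ∈ relations) ∧
    (∀ (N N' : IntegralRep 3),
      N.domain = {x | ∀ i, x i ∈ Set.Ioo (0:ℝ) 1} →
      EqOn N.integrand (fun x => c * (x 0 ^ A * x 1 ^ B * x 2 ^ D) /
        (1 - x 0 ^ K * x 1 ^ K * x 2 ^ K)) N.domain →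
      N'.domain = {x | ∀ i, x i ∈ Set.Ioo (0:ℝ) 1} →
      EqOn N'.integrand (fun x => c * (x 0 ^ A * x 1 ^ D * x 2 ^ B) /
        (1 - x 0 ^ K * x 1 ^ K * x 2 ^ K)) N'.domain →
      of N - of N' ∈ relations) := by
  refine ⟨fun hDA hDB N R hNd hNi hRd hRi =>
      w3_merge_box_sub_band K hK A B D c hc hDA hDB N R hNd hNi hRd hRi, ?_, ?_⟩
  · intro N N' hNd hNi hN'd hN'i
    refine w3_perm_box_sub_mem_relations (Equiv.swap (0 : Fin 3) 1) _ _ N N' hNd hNi hN'd hN'i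
      fun w => ?_
    have h0 : Equiv.swap (0 : Fin 3) 1 0 = 1 := Equiv.swap_apply_left _ _
    have h1 : Equiv.swap (0 : Fin 3) 1 1 = 0 := Equiv.swap_apply_right _ _
    have h2 : Equiv.swap (0 : Fin 3) 1 2 = 2 :=
      Equiv.swap_apply_of_ne_of_ne (by decide) (by decide)
    simp only [h0, h1, h2]
    ring
  · intro N N' hNd hNi hN'd hN'i
    refine w3_perm_box_sub_mem_relations (Equiv.swap (1 : Fin 3) 2) _ _ N N' hNd hNi hN'd hN'i
      fun w => ?_
    have h0 : Equiv.swap (1 : Fin 3) 2 0 = 0 :=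
      Equiv.swap_apply_of_ne_of_ne (by decide) (by decide)
    have h1 : Equiv.swap (1 : Fin 3) 2 1 = 2 := Equiv.swap_apply_left _ _
    have h2 : Equiv.swap (1 : Fin 3) 2 2 = 1 := Equiv.swap_apply_right _ _
    simp only [h0, h1, h2]
    ring

end Summit.KontsevichZagierPeriods.HurwitzMicroSectors.NormalFormPrinciple.PiBox.Weight3
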